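import Literature.NumberTheory.Sieve.CFSemigroupTwisted
import Literature.NumberTheory.Sieve.CFSemigroupPerfect
import HarnessLib

/-!
# Primitivity of the congruence action of the pair twists

Support file (all results proved) for the named fact
`Literature.NumberTheory.Sieve.MageeOhWinter2019_uniformCounting` (`CFSemigroupCounting.lean`).
The congruence transfer operator `𝓜_{s,q}` of `CFSemigroupTwisted.lean` couples the fibres
`ξ ∈ Γ_q = SL₂(ℤ/qℤ)` through the right translations `σ_{(a,b)} = π_q(g_a g_b)⁻¹`. For its leading
eigenvalue at `s = δ_A` to be SIMPLE with no other unimodular eigenvalue (the input replacing the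
positivity of `L_δⁿ 1` in the cone argument of `CFSemigroupSpectralGap.lean`), the translation
digraph must be PRIMITIVE: all fibres are joined by twist-words of every sufficiently large
length. This is the meaning of the exceptional modulus `Q₀` of [MageeOhWinter2019, Thm. 1]. We prove
it for `q` prime to `6 (b - a)` (`a ≠ b ∈ A`):

* `exists_pairWord_of_mem_closure`: the twists generate `Γ_q` as a group
  (`cfSemigroup_map_surjective`), hence — a finite group — as a semigroup: every `ξ` is a
  twist-word product;
* `setGcd_returnLengths_eq_one`: the return lengths at `1` have gcd `1` (a period `d > 1` would
  give a nontrivial character of `Γ_q`, impossible by `CFSemigroupPerfect.lean` for `(q, 6) = 1`);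
* `cfTwist_primitive`: **primitivity**: `∃ n₀, ∀ n ≥ n₀, ∀ ξ η, ∃ w, |w| = n ∧ ξ σ_w = η`
  (Schur's theorem on numerical semigroups, `Nat.exists_mem_closure_of_ge`).
  [cite: MageeOhWinter2019, Thm. 1]

## References

* M. Magee, H. Oh, D. Winter, J. reine angew. Math. 753 (2019) 89–135, Thm. 1, §3.2. [MageeOhWinter2019]
-/

noncomputable section

open Set
open scoped MatrixGroups

namespace Literature.NumberTheory.Sieve

variable {A : Finset ℕ}

/-! ### Twist words -/

variable (A) in
/-- The twist of a word of pairs: `σ_w = σ_{p₁} σ_{p₂} ⋯ σ_{pₙ}`. [cite: MageeOhWinter2019, §3.2] -/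
def cfSigmaWord (q : ℕ) (w : List (A × A)) : SL(2, ZMod q) :=
  (w.map fun p => cfSigma q ((p.1 : A) : ℕ) ((p.2 : A) : ℕ)).prod

/-- `σ_{[]} = 1`. [folklore] -/
@[simp] theorem cfSigmaWord_nil (q : ℕ) : cfSigmaWord A q [] = 1 := by simp [cfSigmaWord]

/-- `σ_{w ++ w'} = σ_w σ_{w'}`. [folklore] -/
theorem cfSigmaWord_append (q : ℕ) (w w' : List (A × A)) :
    cfSigmaWord A q (w ++ w') = cfSigmaWord A q w * cfSigmaWord A q w' := by
  simp [cfSigmaWord, List.map_append, List.prod_append]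

/-- `σ_{[p]} = σ_p`. [folklore] -/
theorem cfSigmaWord_singleton (q : ℕ) (p : A × A) :
    cfSigmaWord A q [p] = cfSigma q ((p.1 : A) : ℕ) ((p.2 : A) : ℕ) := by simp [cfSigmaWord]

/-- Powers of a word: `σ_{w^k} = σ_w^k` (`w^k` the `k`-fold concatenation). [folklore] -/
theorem cfSigmaWord_replicate_flatten (q : ℕ) (w : List (A × A)) (k : ℕ) :
    cfSigmaWord A q (List.replicate k w).flatten = cfSigmaWord A q w ^ k := by
  induction k with
  | zero => simp
  | succ k ih => rw [List.replicate_succ, List.flatten_cons, cfSigmaWord_append, ih, pow_succ']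

/-! ### The twists generate `Γ_q` as a semigroup -/

/-- An even list of letters of `A` is a product of pairs: its matrix product is the matrix of an
element of the subgroup of `SL₂(ℤ)` generated by the `g_a g_b`. [folklore] -/
theorem exists_mem_closure_pairs :
    ∀ (l : List ℕ), Even l.length → (∀ x ∈ l, x ∈ A) →
      ∃ g ∈ Subgroup.closure {γ : SL(2, ℤ) | ∃ a ∈ A, ∃ b ∈ A, γ = cfPair a b},
        (g : Matrix (Fin 2) (Fin 2) ℤ) = (l.map cfGen).prod
  | [], _, _ => ⟨1, Subgroup.one_mem _, by simp⟩
  | [a], h, _ => by simp at h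
  | a :: b :: l, h, hl => by
      have hle : Even l.length := by
        simp only [List.length_cons] at h
        rw [Nat.even_add_one, Nat.even_add_one, not_not] at h
        exact h
      obtain ⟨g, hg, hgl⟩ := exists_mem_closure_pairs l hle fun x hx => hl x (by simp [hx])
      refine ⟨cfPair a b * g, Subgroup.mul_mem _ (Subgroup.subset_closure
        ⟨a, hl a (by simp), b, hl b (by simp), rfl⟩) hg, ?_⟩
      rw [Matrix.SpecialLinearGroup.coe_mul, hgl, List.map_cons, List.map_cons, List.prod_cons, List.prod_cons,
        ← mul_assoc]
      rfl

/-- **The pair images generate `SL₂(ℤ/qℤ)`** for `(q, b - a) = 1`, `a ≠ b ∈ A`. [cite: MageeOhWinter2019, Thm. 1] -/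
theorem closure_cfRed_cfPair_eq_top {a b : ℕ} (ha : a ∈ A) (hb : b ∈ A) {q : ℕ} [NeZero q]
    (hq : IsCoprime ((b : ℤ) - a) q) :
    Subgroup.closure {ξ : SL(2, ZMod q) | ∃ a ∈ A, ∃ b ∈ A, ξ = cfRed q (cfPair a b)} = ⊤ := by
  rw [eq_top_iff]
  intro ξ _
  obtain ⟨γ, hγ, rfl⟩ := cfSemigroup_map_surjective ha hb hq ξ
  obtain ⟨l, -, hle, hlA, hprod⟩ := hγ
  obtain ⟨g, hg, hgl⟩ := exists_mem_closure_pairs l hle hlA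
  have hγg : γ = g := Subtype.ext (by rw [hgl, hprod])
  rw [hγg]
  refine (Subgroup.closure_induction (p := fun g _ => cfRed q g ∈
      Subgroup.closure {ξ : SL(2, ZMod q) | ∃ a ∈ A, ∃ b ∈ A, ξ = cfRed q (cfPair a b)}) ?_ ?_ ?_ ?_ hg)
  · rintro _ ⟨a', ha', b', hb', rfl⟩
    exact Subgroup.subset_closure ⟨a', ha', b', hb', rfl⟩
  · rw [map_one]; exact Subgroup.one_mem _
  · intro x y _ _ hx hy
    rw [map_mul]; exact Subgroup.mul_mem _ hx hy
  · intro x _ hx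
    rw [map_inv]; exact Subgroup.inv_mem _ hx

/-- **Every `ξ ∈ SL₂(ℤ/qℤ)` is a twist-word product** (the twists generate a finite group, hence
generate it as a semigroup). [cite: MageeOhWinter2019, Thm. 1] -/
theorem exists_pairWord {a b : ℕ} (ha : a ∈ A) (hb : b ∈ A) {q : ℕ} [NeZero q]
    (hq : IsCoprime ((b : ℤ) - a) q) (ξ : SL(2, ZMod q)) :
    ∃ w : List (A × A), cfSigmaWord A q w = ξ := by
  -- the set of word products is a subgroup containing the inverses of the generators
  have key : ∀ η ∈ Subgroup.closure {ξ : SL(2, ZMod q) | ∃ a ∈ A, ∃ b ∈ A, ξ = cfRed q (cfPair a b)},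
      ∃ w : List (A × A), cfSigmaWord A q w = η⁻¹ := by
    intro η hη
    refine Subgroup.closure_induction (p := fun η _ => ∃ w : List (A × A), cfSigmaWord A q w = η⁻¹) ?_ ?_ ?_ ?_ hη
    · rintro _ ⟨a', ha', b', hb', rfl⟩
      exact ⟨[(⟨a', ha'⟩, ⟨b', hb'⟩)], by rw [cfSigmaWord_singleton]; rfl⟩
    · exact ⟨[], by simp⟩
    · rintro x y _ _ ⟨wx, hwx⟩ ⟨wy, hwy⟩
      exact ⟨wy ++ wx, by rw [cfSigmaWord_append, hwx, hwy, mul_inv_rev]⟩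
    · rintro x _ ⟨w, hw⟩
      -- `x = (x⁻¹)⁻¹ = σ_w⁻¹ = σ_w^{ord - 1}`
      refine ⟨(List.replicate (orderOf (cfSigmaWord A q w) - 1) w).flatten, ?_⟩
      rw [cfSigmaWord_replicate_flatten, inv_inv]
      have hord := orderOf_pos (cfSigmaWord A q w)
      have h : cfSigmaWord A q w ^ (orderOf (cfSigmaWord A q w) - 1) * cfSigmaWord A q w = 1 := by
        rw [← pow_succ, Nat.sub_add_cancel hord, pow_orderOf_eq_one]
      rw [hw] at h ⊢
      rw [eq_inv_of_mul_eq_one_left h, inv_inv]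
  have hmem : ξ⁻¹ ∈ Subgroup.closure {ξ : SL(2, ZMod q) | ∃ a ∈ A, ∃ b ∈ A, ξ = cfRed q (cfPair a b)} := by
    rw [closure_cfRed_cfPair_eq_top ha hb hq]; exact Subgroup.mem_top _
  obtain ⟨w, hw⟩ := key _ hmem
  exact ⟨w, by rw [hw, inv_inv]⟩

/-! ### The return lengths have gcd one -/

variable (A) in
/-- The set of return lengths: `n` such that some twist-word of length `n` has `σ_w = 1`. [folklore] -/
def cfReturnLengths (q : ℕ) : Set ℕ := {n | ∃ w : List (A × A), w.length = n ∧ cfSigmaWord A q w = 1}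

/-- The return lengths form an additive submonoid. [folklore] -/
def cfReturnMonoid (A : Finset ℕ) (q : ℕ) : AddSubmonoid ℕ where
  carrier := cfReturnLengths A q
  add_mem' := by
    rintro m n ⟨w, hw, hw1⟩ ⟨w', hw', hw'1⟩
    exact ⟨w ++ w', by rw [List.length_append, hw, hw'], by rw [cfSigmaWord_append, hw1, hw'1, one_mul]⟩
  zero_mem' := ⟨[], rfl, by simp⟩

/-- **Word lengths are well defined modulo the gcd of the return lengths:** if two words have the same
twist then their lengths are congruent modulo every common divisor of the return lengths. [folklore] -/
theorem length_modEq_of_cfSigmaWord_eq {a b : ℕ} (ha : a ∈ A) (hb : b ∈ A) {q : ℕ} [NeZero q]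
    (hq : IsCoprime ((b : ℤ) - a) q) {d : ℕ} (hd : ∀ n ∈ cfReturnLengths A q, d ∣ n)
    {w w' : List (A × A)} (h : cfSigmaWord A q w = cfSigmaWord A q w') : w.length ≡ w'.length [MOD d] := by
  obtain ⟨r, hr⟩ := exists_pairWord ha hb hq (cfSigmaWord A q w)⁻¹
  have h1 : w.length + r.length ∈ cfReturnLengths A q :=
    ⟨w ++ r, by rw [List.length_append], by rw [cfSigmaWord_append, hr, mul_inv_cancel]⟩
  have h2 : w'.length + r.length ∈ cfReturnLengths A q :=
    ⟨w' ++ r, by rw [List.length_append], by rw [cfSigmaWord_append, hr, ← h, mul_inv_cancel]⟩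
  exact Nat.ModEq.add_right_cancel' r.length ((Nat.modEq_zero_iff_dvd.2 (hd _ h1)).trans
    (Nat.modEq_zero_iff_dvd.2 (hd _ h2)).symm)

/-- **The return lengths have gcd `1`** for `q` prime to `6 (b - a)`: otherwise
`ξ ↦ ζ_d^{|w_ξ|}` (`ζ_d` a primitive `d`-th root of unity, `w_ξ` any word with twist `ξ`) is a
nowhere-zero function with `f(ξ σ) = ζ_d f(ξ)` for every twist `σ`, forcing `ζ_d = 1` by
`eq_one_of_graded_function` and the perfectness of `SL₂(ℤ/qℤ)`. [cite: MageeOhWinter2019, Thm. 1] -/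
theorem setGcd_cfReturnLengths_eq_one {a b : ℕ} (ha : a ∈ A) (hb : b ∈ A) {q : ℕ} [NeZero q]
    (hq6 : Nat.Coprime q 6) (hq : IsCoprime ((b : ℤ) - a) q) : Nat.setGcd (cfReturnLengths A q) = 1 := by
  set d := Nat.setGcd (cfReturnLengths A q) with hddef
  have hd : ∀ n ∈ cfReturnLengths A q, d ∣ n := fun n hn => Nat.setGcd_dvd_of_mem hn
  -- `d ≠ 0`: there is a positive return length (the order of a single twist)
  have hd0 : d ≠ 0 := by
    intro h0
    have hsub := (Nat.setGcd_eq_zero_iff.1 h0)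
    set σ := cfSigmaWord A q [(⟨a, ha⟩, ⟨a, ha⟩)] with hσ
    have hmem : orderOf σ ∈ cfReturnLengths A q := by
      refine ⟨(List.replicate (orderOf σ) [(⟨a, ha⟩, ⟨a, ha⟩)]).flatten, ?_, ?_⟩
      · simp
      · rw [cfSigmaWord_replicate_flatten, pow_orderOf_eq_one]
    have := hsub hmem
    rw [Set.mem_singleton_iff] at this
    exact (orderOf_pos σ).ne' this
  -- suppose `d ≠ 1` and build the graded function
  by_contra hd1
  have hd2 : 1 < d := by omega
  choose wd hwd using exists_pairWord ha hb hq (A := A)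
  set ζ : ℂ := Complex.exp (2 * Real.pi * Complex.I / (d : ℂ)) with hζ
  have hζprim : IsPrimitiveRoot ζ d := Complex.isPrimitiveRoot_exp d hd0
  have hζ0 : ζ ≠ 0 := hζprim.ne_zero hd0
  set f : SL(2, ZMod q) → ℂ := fun ξ => ζ ^ (wd ξ).length with hf
  have hfne : ∀ ξ, f ξ ≠ 0 := fun ξ => pow_ne_zero _ hζ0
  have hrel : ∀ ξ, ∀ s ∈ {σ : SL(2, ZMod q) | ∃ p : A × A, σ = cfSigma q ((p.1 : A) : ℕ) ((p.2 : A) : ℕ)},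
      f (ξ * s) = ζ * f ξ := by
    rintro ξ _ ⟨p, rfl⟩
    simp only [hf]
    -- the chosen word for `ξ σ_p` has length `≡ |w_ξ| + 1 (mod d)`
    have hcong : (wd (ξ * cfSigma q ((p.1 : A) : ℕ) ((p.2 : A) : ℕ))).length ≡ (wd ξ ++ [p]).length [MOD d] := by
      refine length_modEq_of_cfSigmaWord_eq ha hb hq hd ?_
      rw [hwd, cfSigmaWord_append, hwd, cfSigmaWord_singleton]
    rw [List.length_append, List.length_singleton] at hcong
    have hmod : ∀ m : ℕ, ζ ^ m = ζ ^ (m % d) := fun m => by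
      conv_lhs => rw [← Nat.mod_add_div m d, pow_add, pow_mul, hζprim.pow_eq_one, one_pow, mul_one]
    rw [hmod, hcong, ← hmod, pow_succ, mul_comm]
  -- the twists generate `Γ_q`
  have hS : Subgroup.closure {σ : SL(2, ZMod q) | ∃ p : A × A, σ = cfSigma q ((p.1 : A) : ℕ) ((p.2 : A) : ℕ)} = ⊤ := by
    rw [eq_top_iff]
    intro ξ _
    rw [← hwd ξ]
    -- word products lie in the closure
    suffices hw : ∀ w : List (A × A), cfSigmaWord A q w ∈
        Subgroup.closure {σ : SL(2, ZMod q) | ∃ p : A × A, σ = cfSigma q ((p.1 : A) : ℕ) ((p.2 : A) : ℕ)} from hw _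
    intro w
    induction w with
    | nil => rw [cfSigmaWord_nil]; exact Subgroup.one_mem _
    | cons p w ih =>
        rw [show p :: w = [p] ++ w from rfl, cfSigmaWord_append, cfSigmaWord_singleton]
        exact Subgroup.mul_mem _ (Subgroup.subset_closure ⟨p, rfl⟩) ih
  have hSne : ({σ : SL(2, ZMod q) | ∃ p : A × A, σ = cfSigma q ((p.1 : A) : ℕ) ((p.2 : A) : ℕ)}).Nonempty :=
    ⟨_, (⟨a, ha⟩, ⟨a, ha⟩), rfl⟩
  have hζ1 : ζ = 1 :=
    eq_one_of_graded_function hSne hS (fun χ => monoidHom_eq_one_of_comm hq6 χ) hfne hrel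
  rw [hζ1] at hζprim
  exact hd1 (hζprim.eq_orderOf.trans orderOf_one)

/-! ### Primitivity -/

/-- All sufficiently large integers are return lengths (Schur's theorem for the numerical semigroup of
return lengths, whose gcd is `1`). [folklore] -/
theorem exists_mem_cfReturnLengths_of_ge {a b : ℕ} (ha : a ∈ A) (hb : b ∈ A) {q : ℕ} [NeZero q]
    (hq6 : Nat.Coprime q 6) (hq : IsCoprime ((b : ℤ) - a) q) : ∃ N : ℕ, ∀ n ≥ N, n ∈ cfReturnLengths A q := by
  obtain ⟨N, hN⟩ := Nat.exists_mem_closure_of_ge (s := cfReturnLengths A q)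
  refine ⟨N, fun n hn => ?_⟩
  have h := hN n hn (by rw [setGcd_cfReturnLengths_eq_one ha hb hq6 hq]; exact one_dvd n)
  have hle : AddSubmonoid.closure (cfReturnLengths A q) ≤ cfReturnMonoid A q :=
    AddSubmonoid.closure_le.2 fun x hx => hx
  exact hle h

/-- **Primitivity of the congruence twists** ([MageeOhWinter2019, Thm. 1]: for `q` prime to the
exceptional modulus, here `6 (b - a)` with `a ≠ b ∈ A`): there is `n₀` such that for every `n ≥ n₀`
any two fibres `ξ, η ∈ SL₂(ℤ/qℤ)` are joined by a twist-word of length exactly `n`: `ξ σ_w = η`.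
[cite: MageeOhWinter2019, Thm. 1] -/
theorem cfTwist_primitive {a b : ℕ} (ha : a ∈ A) (hb : b ∈ A) {q : ℕ} [NeZero q]
    (hq6 : Nat.Coprime q 6) (hq : IsCoprime ((b : ℤ) - a) q) :
    ∃ n₀ : ℕ, ∀ n ≥ n₀, ∀ ξ η : SL(2, ZMod q), ∃ w : List (A × A), w.length = n ∧ ξ * cfSigmaWord A q w = η := by
  obtain ⟨N, hN⟩ := exists_mem_cfReturnLengths_of_ge ha hb hq6 hq
  choose wd hwd using exists_pairWord ha hb hq (A := A)
  set B : ℕ := Finset.univ.sup fun g : SL(2, ZMod q) => (wd g).length with hB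
  refine ⟨N + B, fun n hn ξ η => ?_⟩
  have hle : (wd (ξ⁻¹ * η)).length ≤ B := Finset.le_sup (f := fun g : SL(2, ZMod q) => (wd g).length) (Finset.mem_univ _)
  obtain ⟨r, hrlen, hr1⟩ := hN (n - (wd (ξ⁻¹ * η)).length) (by omega)
  refine ⟨r ++ wd (ξ⁻¹ * η), by rw [List.length_append, hrlen]; omega, ?_⟩
  rw [cfSigmaWord_append, hr1, one_mul, hwd, mul_inv_cancel_left]

end Literature.NumberTheory.Sieve
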